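import Summits.KontsevichZagierPeriods.KontsevichZagierPeriods.Theorems.BetaCancellation.Negative.LoadBearing
import Literature.NumberTheory.Transcendental.KZMellinFibres

/-!
# `TriplicationFromMultiplication` (stmt-KontsevichZagierPeriods-13693) — part 1: Beta and
simplex representations, and Dirichlet's chart as ONE rule-(2) move

Helper file for the cancellation glue `MultiplicationThree → ReflectionThird → BetaCancellation →
TriplicationAccessible` of route TerasomaMultiplication. No new definitions: the Beta representation
`β(a,b) = [(0,1), t^{a-1}(1-t)^{b-1}]` and the simplex representation
`Δ(a,b,c) = [{u,v>0, u+v<1}, u^{a-1}v^{b-1}(1-u-v)^{c-1}]` are the box-Mellin members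
`KZ.IntegralRep.ofMellin` of the families `(X₀, 1−X₀)` on `ℝ¹` and `(X₀, X₁, 1−X₀−X₁)` on `ℝ²`
(vocabulary of `KZMellinFibres`), with the convergence proofs supplied here.

Main result: `dirichlet` — for positive rationals `a b c` and `d = a + b`,
`[β(a,b)] × [β(d,c)] ∼ [Δ(a,b,c)]` by the single change of variables `(x,y) ↦ (xy, (1−x)y)` of
the open box onto the open simplex (Jacobian `y`), i.e. Dirichlet's formula
`B(a,b)B(a+b,c) = ∫∫_Δ u^{a-1}v^{b-1}(1-u-v)^{c-1}` inside the Kontsevich–Zagier calculus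
(Andrews–Askey–Roy 1999, Thm. 1.8.1 is the value shadow).
-/

noncomputable section

open MeasureTheory Set
open scoped BigOperators

namespace Summit.KontsevichZagierPeriods.TerasomaMultiplication.TriplicationGlue

open Literature.NumberTheory.Transcendental
open Literature.NumberTheory.Transcendental.KZ
open Literature.ModelTheory.ExponentialFields (IsSemialgebraic)
open MvPolynomial (aeval X C)
open Summit.KontsevichZagierPeriods.KontsevichZagierPeriods.BetaCancellationNegative
  (betaKernel integrableOn_betaKernel_and_integral_eq integrableOn_comp_apply_zero_iff)
open Literature.NumberTheory.Transcendental.KZreg (unitIoo)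

/-- The Beta family `(X₀, 1 − X₀)` on `ℝ¹` (local notation `bF`). -/
local notation "bF" => (![MvPolynomial.X 0, 1 - MvPolynomial.X 0] : Fin 2 → MvPolynomial (Fin 1) ℚ)

/-- The simplex family `(X₀, X₁, 1 − X₀ − X₁)` on `ℝ²` (local notation `sF`). -/
local notation "sF" => (![MvPolynomial.X 0, MvPolynomial.X 1, 1 - MvPolynomial.X 0 - MvPolynomial.X 1] :
  Fin 3 → MvPolynomial (Fin 2) ℚ)

/-! ## The Beta representation `β(a,b) = ofMellin bF (a-1, b-1) 1` -/

/-- Membership in the Mellin box of the Beta family: `x₀ ∈ (0,1)`. [folklore] -/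
theorem mem_mellinBox_bF {x : Fin 1 → ℝ} : x ∈ mellinBox bF ↔ x 0 ∈ Ioo (0:ℝ) 1 := by
  simp only [mem_mellinBox, Fin.forall_fin_one, Fin.forall_fin_two, Matrix.cons_val_zero,
    Matrix.cons_val_one, map_sub, map_one, MvPolynomial.aeval_X, sub_pos, mem_Ioo]
  tauto

/-- The Mellin box of the Beta family is the open unit interval `KZreg.unitIoo`. [folklore] -/
theorem mellinBox_bF_eq : mellinBox bF = unitIoo := by
  ext x
  rw [mem_mellinBox_bF]
  rfl

/-- The Mellin box of the Beta family in the crux's spelling. [folklore] -/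
theorem mellinBox_bF_eq_setOf : mellinBox bF = {x : Fin 1 → ℝ | x 0 ∈ Ioo (0:ℝ) 1} := by
  ext x
  exact mem_mellinBox_bF

/-- The Euler–Mellin integrand of the Beta family with exponents `(a-1, b-1)` is the Beta kernel
`t^{a-1}(1-t)^{b-1}`. [folklore] -/
theorem mellinIntegrand_bF (a b : ℚ) (x : Fin 1 → ℝ) :
    mellinIntegrand bF ![a - 1, b - 1] 1 x = betaKernel a b (x 0) := by
  simp [mellinIntegrand, betaKernel, Fin.prod_univ_two]

/-- **Convergence of the Beta integral**: the datum `(bF, (a-1,b-1), 1)` converges for `0 < a`,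
`0 < b`. [folklore] -/
theorem integrableOn_beta {a b : ℚ} (ha : 0 < a) (hb : 0 < b) :
    IntegrableOn (mellinIntegrand bF ![a - 1, b - 1] 1) (mellinBox bF) := by
  rw [mellinBox_bF_eq_setOf, show mellinIntegrand bF ![a - 1, b - 1] 1 = fun x => betaKernel a b (x 0) from
    funext (mellinIntegrand_bF a b)]
  exact integrableOn_comp_apply_zero_iff.2 (integrableOn_betaKernel_and_integral_eq ha hb).1

/-! ## The simplex representation `Δ(a,b,c) = ofMellin sF (a-1, b-1, c-1) 1` -/

/-- Membership in the Mellin box of the simplex family: the open simplex `u, v > 0`, `u + v < 1`.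
[folklore] -/
theorem mem_mellinBox_sF {z : Fin 2 → ℝ} : z ∈ mellinBox sF ↔ 0 < z 0 ∧ 0 < z 1 ∧ z 0 + z 1 < 1 := by
  constructor
  · rintro ⟨-, hp⟩
    have h0 := hp 0
    have h1 := hp 1
    have h2 := hp 2
    simp only [Matrix.cons_val_zero, Matrix.cons_val_one, Matrix.cons_val, map_sub, map_one,
      MvPolynomial.aeval_X] at h0 h1 h2
    exact ⟨h0, h1, by linarith⟩
  · rintro ⟨h0, h1, h2⟩
    refine ⟨Fin.forall_fin_two.mpr ⟨⟨h0, by linarith⟩, ⟨h1, by linarith⟩⟩, fun k => ?_⟩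
    fin_cases k
    · simpa using h0
    · simpa using h1
    · simp only [Fin.reduceFinMk, Matrix.cons_val, map_sub, map_one, MvPolynomial.aeval_X]
      linarith

/-- The Euler–Mellin integrand of the simplex family with exponents `(a-1, b-1, c-1)`. [folklore] -/
theorem mellinIntegrand_sF (a b c : ℚ) (z : Fin 2 → ℝ) :
    mellinIntegrand sF ![a - 1, b - 1, c - 1] 1 z =
      (z 0) ^ ((a:ℝ) - 1) * (z 1) ^ ((b:ℝ) - 1) * (1 - z 0 - z 1) ^ ((c:ℝ) - 1) := by
  simp [mellinIntegrand, Fin.prod_univ_three, mul_assoc]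

/-! ## Dirichlet's chart `Φ(x,y) = (xy, (1−x)y)` of the simplex by the box -/

/-- Dirichlet's chart `Φ(x, y) = (xy, (1 − x)y)`, written as a polynomial substitution evaluated
at `z` (so that semialgebraicity is `isSemialgebraicMapOn_aeval`). [folklore] -/
theorem dirichletChart_apply (z : Fin 2 → ℝ) :
    (fun i => aeval z ((![X 0 * X 1, (1 - X 0) * X 1] : Fin 2 → MvPolynomial (Fin 2) ℚ) i)) =
      ![z 0 * z 1, (1 - z 0) * z 1] := by
  funext i
  fin_cases i <;> simp

/-- The Jacobian matrix `[[y, x], [−y, 1−x]]` of Dirichlet's chart, as a continuous linear map;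
its determinant is `y`. [folklore] -/
theorem det_dirichletJac (z : Fin 2 → ℝ) :
    (LinearMap.toContinuousLinearMap
      (Matrix.toLin' (!![z 1, z 0; -(z 1), 1 - z 0] : Matrix (Fin 2) (Fin 2) ℝ))).det = z 1 := by
  rw [ContinuousLinearMap.det, LinearMap.coe_toContinuousLinearMap, LinearMap.det_toLin',
    Matrix.det_fin_two_of]
  ring

/-- The Jacobian applied to a vector. [folklore] -/
theorem dirichletJac_apply (z v : Fin 2 → ℝ) :
    (LinearMap.toContinuousLinearMap
      (Matrix.toLin' (!![z 1, z 0; -(z 1), 1 - z 0] : Matrix (Fin 2) (Fin 2) ℝ))) v =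
      ![z 1 * v 0 + z 0 * v 1, -(z 1) * v 0 + (1 - z 0) * v 1] := by
  rw [LinearMap.coe_toContinuousLinearMap', Matrix.toLin'_apply]
  funext i
  fin_cases i <;> simp [Matrix.mulVec, dotProduct, Fin.sum_univ_two]

/-- Dirichlet's chart is differentiable with the stated Jacobian. [folklore] -/
theorem hasFDerivAt_dirichletChart (z : Fin 2 → ℝ) :
    HasFDerivAt (fun w : Fin 2 → ℝ => (![w 0 * w 1, (1 - w 0) * w 1] : Fin 2 → ℝ))
      (LinearMap.toContinuousLinearMap
        (Matrix.toLin' (!![z 1, z 0; -(z 1), 1 - z 0] : Matrix (Fin 2) (Fin 2) ℝ))) z := by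
  have h0 : HasFDerivAt (fun y : Fin 2 → ℝ => y 0)
      (ContinuousLinearMap.proj (R := ℝ) (φ := fun _ : Fin 2 => ℝ) 0) z :=
    hasFDerivAt_apply 0 z
  have h1 : HasFDerivAt (fun y : Fin 2 → ℝ => y 1)
      (ContinuousLinearMap.proj (R := ℝ) (φ := fun _ : Fin 2 => ℝ) 1) z :=
    hasFDerivAt_apply 1 z
  rw [hasFDerivAt_pi']
  refine Fin.forall_fin_two.mpr ⟨?_, ?_⟩
  · have hf : (fun w : Fin 2 → ℝ => (![w 0 * w 1, (1 - w 0) * w 1] : Fin 2 → ℝ) 0) =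
        fun w => w 0 * w 1 := funext fun w => rfl
    rw [hf]
    refine (h0.mul h1).congr_fderiv (ContinuousLinearMap.ext fun v => ?_)
    rw [ContinuousLinearMap.coe_comp, Function.comp_apply, dirichletJac_apply]
    simp only [add_apply, FunLike.coe_smul, Pi.smul_apply, ContinuousLinearMap.proj_apply, smul_eq_mul,
      Matrix.cons_val_zero]
    ring
  · have hf : (fun w : Fin 2 → ℝ => (![w 0 * w 1, (1 - w 0) * w 1] : Fin 2 → ℝ) 1) =
        fun w => (1 - w 0) * w 1 := funext fun w => rfl
    rw [hf]
    refine ((h0.const_sub 1).mul h1).congr_fderiv (ContinuousLinearMap.ext fun v => ?_)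
    rw [ContinuousLinearMap.coe_comp, Function.comp_apply, dirichletJac_apply]
    simp only [add_apply, FunLike.coe_smul, Pi.smul_apply, ContinuousLinearMap.proj_apply, smul_eq_mul,
      neg_apply, Matrix.cons_val_zero, Matrix.cons_val_one]
    ring

/-- Dirichlet's chart is injective on `{y ≠ 0}` (so on the open box): `y = u + v`, `x = u / y`.
[folklore] -/
theorem injOn_dirichletChart {s : Set (Fin 2 → ℝ)} (hs : ∀ z ∈ s, z 1 ≠ 0) :
    InjOn (fun w : Fin 2 → ℝ => (![w 0 * w 1, (1 - w 0) * w 1] : Fin 2 → ℝ)) s := by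
  intro z hz w hw hzw
  have h0 := congrFun hzw 0
  have h1 := congrFun hzw 1
  simp only [Matrix.cons_val_zero, Matrix.cons_val_one] at h0 h1
  have hy : z 1 = w 1 := by linarith
  have hx : z 0 = w 0 := by
    rw [hy] at h0
    exact mul_right_cancel₀ (hs w hw) h0
  funext i
  fin_cases i
  · exact hx
  · exact hy

/-- **Dirichlet's chart maps the open box ONTO the open simplex.** [folklore] -/
theorem image_dirichletChart_box :
    (fun w : Fin 2 → ℝ => (![w 0 * w 1, (1 - w 0) * w 1] : Fin 2 → ℝ)) ''
        {z | z 0 ∈ Ioo (0:ℝ) 1 ∧ z 1 ∈ Ioo (0:ℝ) 1} = mellinBox sF := by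
  ext u
  rw [mem_mellinBox_sF]
  constructor
  · rintro ⟨z, ⟨⟨hx0, hx1⟩, ⟨hy0, hy1⟩⟩, rfl⟩
    simp only [Matrix.cons_val_zero, Matrix.cons_val_one]
    refine ⟨mul_pos hx0 hy0, mul_pos (by linarith) hy0, by nlinarith⟩
  · rintro ⟨hu, hv, huv⟩
    have hy : 0 < u 0 + u 1 := by linarith
    refine ⟨![u 0 / (u 0 + u 1), u 0 + u 1], ⟨⟨by simp; positivity, ?_⟩, ⟨by simpa using hy, by simpa using huv⟩⟩, ?_⟩
    · simp only [Matrix.cons_val_zero]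
      rw [div_lt_one hy]
      linarith
    · funext i
      fin_cases i
      · simp only [Matrix.cons_val_zero, Matrix.cons_val_one, Fin.zero_eta]
        field_simp
      · simp only [Matrix.cons_val_zero, Matrix.cons_val_one, Fin.mk_one]
        field_simp
        ring

/-- **The pull-back identity of Dirichlet's chart**: for `x, y ∈ (0,1)` and `d = a + b`,
`x^{a-1}(1-x)^{b-1} · y^{d-1}(1-y)^{c-1} = (Δ-integrand ∘ Φ)(x,y) · |y|`. [folklore] -/
theorem dirichlet_pullback {a b c d : ℚ} (hd : d = a + b) {z : Fin 2 → ℝ}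
    (hz : z 0 ∈ Ioo (0:ℝ) 1 ∧ z 1 ∈ Ioo (0:ℝ) 1) :
    betaKernel a b (z 0) * betaKernel d c (z 1) =
      mellinIntegrand sF ![a - 1, b - 1, c - 1] 1 (![z 0 * z 1, (1 - z 0) * z 1]) * |z 1| := by
  obtain ⟨⟨hx0, hx1⟩, ⟨hy0, hy1⟩⟩ := hz
  have hx1' : 0 < 1 - z 0 := by linarith
  rw [mellinIntegrand_sF, abs_of_pos hy0]
  simp only [Matrix.cons_val_zero, Matrix.cons_val_one, betaKernel]
  have hd' : (d:ℝ) = a + b := by rw [hd]; push_cast; ring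
  rw [Real.mul_rpow hx0.le hy0.le, Real.mul_rpow hx1'.le hy0.le,
    show 1 - z 0 * z 1 - (1 - z 0) * z 1 = 1 - z 1 by ring, hd']
  have hy : z 1 ^ ((a:ℝ) + b - 1) = z 1 ^ ((a:ℝ) - 1) * z 1 ^ ((b:ℝ) - 1) * z 1 := by
    rw [← Real.rpow_add hy0, ← Real.rpow_add_one hy0.ne']
    congr 1
    ring
  rw [hy]
  ring

/-! ## Products of two Beta representations, and the Dirichlet move -/

/-- The Beta representation `β(a,b) = [(0,1), t^{a-1}(1-t)^{b-1}]` as the box-Mellin member of the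
Beta family (local notation; `h` is the convergence proof, e.g. `integrableOn_beta ha hb`). -/
local notation "𝛃(" a ", " b ", " h ")" =>
  IntegralRep.ofMellin (![MvPolynomial.X 0, 1 - MvPolynomial.X 0] : Fin 2 → MvPolynomial (Fin 1) ℚ)
    ![a - 1, b - 1] 1 h

/-- The simplex representation `Δ(a,b,c) = [{u,v>0,u+v<1}, u^{a-1}v^{b-1}(1-u-v)^{c-1}]` as the
box-Mellin member of the simplex family (local notation; `h` is the convergence proof). -/
local notation "𝚫(" a ", " b ", " c ", " h ")" =>
  IntegralRep.ofMellin (![MvPolynomial.X 0, MvPolynomial.X 1, 1 - MvPolynomial.X 0 - MvPolynomial.X 1] :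
    Fin 3 → MvPolynomial (Fin 2) ℚ) ![a - 1, b - 1, c - 1] 1 h

/-- The head coordinate of `ℝ^{1+1}`. [folklore] -/
theorem castAdd_one_zero : (Fin.castAdd 1 (0 : Fin 1) : Fin (1 + 1)) = 0 := rfl

/-- The tail coordinate of `ℝ^{1+1}`. [folklore] -/
theorem natAdd_one_zero : (Fin.natAdd 1 (0 : Fin 1) : Fin (1 + 1)) = 1 := rfl

/-- The domain of a product of two Beta representations is the open box `(0,1)²`. [folklore] -/
theorem mem_prod_beta_domain {a b a' b' : ℚ}
    {h : IntegrableOn (mellinIntegrand bF ![a - 1, b - 1] 1) (mellinBox bF) volume}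
    {h' : IntegrableOn (mellinIntegrand bF ![a' - 1, b' - 1] 1) (mellinBox bF) volume} {z : Fin (1 + 1) → ℝ} :
    z ∈ ((𝛃(a, b, h)).prod (𝛃(a', b', h'))).domain ↔ z 0 ∈ Ioo (0:ℝ) 1 ∧ z 1 ∈ Ioo (0:ℝ) 1 := by
  rw [IntegralRep.prod_domain, IntegralRep.mem_prodDomain, IntegralRep.ofMellin_domain,
    IntegralRep.ofMellin_domain, mem_mellinBox_bF, mem_mellinBox_bF, castAdd_one_zero, natAdd_one_zero]

/-- The domain of a product of two Beta representations, as a set. [folklore] -/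
theorem prod_beta_domain {a b a' b' : ℚ}
    (h : IntegrableOn (mellinIntegrand bF ![a - 1, b - 1] 1) (mellinBox bF) volume)
    (h' : IntegrableOn (mellinIntegrand bF ![a' - 1, b' - 1] 1) (mellinBox bF) volume) :
    ((𝛃(a, b, h)).prod (𝛃(a', b', h'))).domain = {z | z 0 ∈ Ioo (0:ℝ) 1 ∧ z 1 ∈ Ioo (0:ℝ) 1} :=
  Set.ext fun _ => mem_prod_beta_domain

/-- The integrand of a product of two Beta representations is the product of the two Beta kernels.
[folklore] -/
theorem prod_beta_integrand {a b a' b' : ℚ}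
    (h : IntegrableOn (mellinIntegrand bF ![a - 1, b - 1] 1) (mellinBox bF) volume)
    (h' : IntegrableOn (mellinIntegrand bF ![a' - 1, b' - 1] 1) (mellinBox bF) volume) (z : Fin (1 + 1) → ℝ) :
    ((𝛃(a, b, h)).prod (𝛃(a', b', h'))).integrand z = betaKernel a b (z 0) * betaKernel a' b' (z 1) := by
  rw [IntegralRep.prod_integrand_eq]
  simp only [IntegralRep.prodFun, IntegralRep.ofMellin_integrand, mellinIntegrand_bF, castAdd_one_zero,
    natAdd_one_zero]

/-- The open box `(0,1)² ⊆ ℝ²` is measurable. [folklore] -/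
theorem measurableSet_box2 : MeasurableSet {z : Fin 2 → ℝ | z 0 ∈ Ioo (0:ℝ) 1 ∧ z 1 ∈ Ioo (0:ℝ) 1} :=
  (measurableSet_Ioo.preimage (measurable_pi_apply 0)).inter
    (measurableSet_Ioo.preimage (measurable_pi_apply 1))

/-- **Convergence of Dirichlet's simplex integral** `∫∫_Δ u^{a-1}v^{b-1}(1-u-v)^{c-1}` for positive
rational `a, b, c` (pulled back along Dirichlet's chart it is the product of two Beta kernels,
Mathlib's Jacobian criterion `integrableOn_image_iff_integrableOn_abs_det_fderiv_smul`). [folklore] -/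
theorem integrableOn_simplex {a b c : ℚ} (ha : 0 < a) (hb : 0 < b) (hc : 0 < c) :
    IntegrableOn (mellinIntegrand sF ![a - 1, b - 1, c - 1] 1) (mellinBox sF) := by
  have hab : 0 < a + b := by positivity
  set P := (𝛃(a, b, integrableOn_beta ha hb)).prod (𝛃(a + b, c, integrableOn_beta hab hc)) with hP
  have hdom := prod_beta_domain (integrableOn_beta ha hb) (integrableOn_beta hab hc)
  have hint := P.integrableOn
  rw [hdom] at hint
  rw [← image_dirichletChart_box, integrableOn_image_iff_integrableOn_abs_det_fderiv_smul volume
    measurableSet_box2 (fun x _ => (hasFDerivAt_dirichletChart x).hasFDerivWithinAt)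
    (injOn_dirichletChart fun z hz => hz.2.1.ne')]
  refine hint.congr_fun (fun z hz => ?_) measurableSet_box2
  rw [hP, prod_beta_integrand, dirichlet_pullback rfl hz, det_dirichletJac, smul_eq_mul, mul_comm]

/-- **Dirichlet's move**: for positive rationals `a, b, c` and `d = a + b`,
`[β(a,b)] × [β(d,c)] − [Δ(a,b,c)]` is ONE change-of-variables move (rule 2) along Dirichlet's chart
`(x,y) ↦ (xy, (1−x)y)` of the open box onto the open simplex, Jacobian `y`; value shadow
`B(a,b)B(a+b,c) = Γ(a)Γ(b)Γ(c)/Γ(a+b+c)`. [cite: KontsevichZagier2001, §1.2 rule (2)] -/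
theorem dirichlet_mem_changeOfVariablesRel {a b c d : ℚ} (hd : d = a + b)
    (h₁ : IntegrableOn (mellinIntegrand bF ![a - 1, b - 1] 1) (mellinBox bF) volume)
    (h₂ : IntegrableOn (mellinIntegrand bF ![d - 1, c - 1] 1) (mellinBox bF) volume)
    (h₃ : IntegrableOn (mellinIntegrand sF ![a - 1, b - 1, c - 1] 1) (mellinBox sF) volume) :
    of ((𝛃(a, b, h₁)).prod (𝛃(d, c, h₂))) - of (𝚫(a, b, c, h₃)) ∈ changeOfVariablesRel := by
  set P := (𝛃(a, b, h₁)).prod (𝛃(d, c, h₂)) with hP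
  have hdom := prod_beta_domain h₁ h₂
  refine ⟨2, P, 𝚫(a, b, c, h₃), fun w => ![w 0 * w 1, (1 - w 0) * w 1],
    fun z => LinearMap.toContinuousLinearMap
      (Matrix.toLin' (!![z 1, z 0; -(z 1), 1 - z 0] : Matrix (Fin 2) (Fin 2) ℝ)),
    ?_, fun x _ => (hasFDerivAt_dirichletChart x).hasFDerivWithinAt, ?_, ?_, ?_, rfl⟩
  · exact (isSemialgebraicMapOn_aeval P.isSemialgebraic_domain
      (![X 0 * X 1, (1 - X 0) * X 1] : Fin 2 → MvPolynomial (Fin 2) ℚ)).congr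
      fun z _ => dirichletChart_apply z
  · rw [hP, hdom]
    exact injOn_dirichletChart fun z hz => hz.2.1.ne'
  · rw [hP, hdom, image_dirichletChart_box, IntegralRep.ofMellin_domain]
  · intro z hz
    rw [hP, hdom] at hz
    rw [hP, prod_beta_integrand, det_dirichletJac, IntegralRep.ofMellin_integrand]
    exact dirichlet_pullback hd hz

/-- **Dirichlet's formula inside the calculus**: `[β(a,b)] × [β(a+b,c)] ∼ [Δ(a,b,c)]`. [folklore] -/
theorem dirichlet {a b c d : ℚ} (hd : d = a + b)
    (h₁ : IntegrableOn (mellinIntegrand bF ![a - 1, b - 1] 1) (mellinBox bF) volume)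
    (h₂ : IntegrableOn (mellinIntegrand bF ![d - 1, c - 1] 1) (mellinBox bF) volume)
    (h₃ : IntegrableOn (mellinIntegrand sF ![a - 1, b - 1, c - 1] 1) (mellinBox sF) volume) :
    Equivalent ((𝛃(a, b, h₁)).prod (𝛃(d, c, h₂))) (𝚫(a, b, c, h₃)) :=
  changeOfVariablesRel_subset_relations (dirichlet_mem_changeOfVariablesRel hd h₁ h₂ h₃)

end Summit.KontsevichZagierPeriods.TerasomaMultiplication.TriplicationGlue
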